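import Summits.Schanuel.Schanuel.Theorems.RootDecomp1BMovingZero16

/-!
# RootDecomp1BMovingZero — lens 4, generation 38 «CURVE SELECTION UNCONDITIONAL» (lane B-R24 (a)): the T-fact binder `CurveSelection` of part 09 DISCHARGED by a sorry-free proof BY NAME (`curveSelection_holds`) via the tree SCV library (Weierstrass box, discriminant roots) + the tree's analytic Abhyankar–Jung (Puiseux) theorem; T″ modulo Ax only; the (1|ρ) cell modulo {Ax, IsolatedPointBound} + the measures — continuation (RootDecomp1BMovingZero17): §2 engine at the origin + §3 reductions + §4 `curveSelection_holds` + §5 read-outs mod {Ax, IsolatedPointBound}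

(lens-4 g38 HOME kernel CurveSelectionDischarge.lean 576f8ec8…, 688 l, imports Literature AbhyankarJungAnalytic + AnalyticCover + tree MovingZero15; CLAIM L2013, CHECKLIST B-g38 L2015, NODE L2026 / REQUEST L2027 / RESULT L2028, critic VERDICT L2031 (crit g8: CLEARED — THEOREM ×1; lens-4 tally THEOREM ×5 + CELL ×2; PORT GO 16/17, `--supports stmt-Schanuel-24622`, kind proof); port by census-1 gen 17 as `RootDecomp1BMovingZero16`–`17`: 16 = §0 helpers + §1 Weierstrass box (distinct slice roots, sheets, reduced polynomial) in `namespace CurveSel`; 17 = §2 the engine at the origin + §3 reductions (a line with F ≢ 0, affine frame) + §4 THE DISCHARGE `curveSelection_holds : CurveSelection` + §5 read-outs `isolatedIntersectionGeneral_of_ax`, `movingZeroApprox_of_two_facts : AxRankBoundLaurent → IsolatedPointBound → ∀ ρ, MovingZeroApprox ρ`, `four_le_polarDeg_one_of_two_facts` (+ swap / hyper / rhoT).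
PORT EDITS: the axiom-guard section, unused `import HarnessLib` and the `dupNamespace` option dropped; statements and proofs verbatim (theorem type = the tree def BY NAME). `--supports stmt-Schanuel-24622`; no census credit carried; rung 0.)
-/

open Complex Filter Topology Metric Set Polynomial
open Literature.Analysis.Complex.SCV (WeierstrassData sliceRoots rootMultiset exists_weierstrassData
  mem_rootMultiset_iff)

namespace Summit.Schanuel.Schanuel.Theorems.RootDecomp1BMovingZero

namespace CurveSel

/-! ### §2  The engine at the origin -/

/-- **Curve selection at the origin for a pair `(F, G)` in Weierstrass position.**  `F, G` analytic on an open
`Ω ∋ 0`, `F 0 = 0`, the base slice `F (0, ·) ≢ 0` near `0`, and `0` a non-isolated common zero: then some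
analytic curve `γ` with `γ 0 = 0`, `γ s ≠ 0` for `s ≠ 0`, lies in `{F = 0} ∩ {G = 0}` near `s = 0`.
[cite: Chirka1989, §3.5 Prop. 1, §6.1] [cite: ParusinskiRond2012, Prop. 2.1] -/
theorem exists_curve_at_zero {F G : ℂ × ℂ → ℂ} {Ω : Set (ℂ × ℂ)} (hΩ : IsOpen Ω) (h0 : (0 : ℂ × ℂ) ∈ Ω)
    (hF : AnalyticOnNhd ℂ F Ω) (hG : AnalyticOnNhd ℂ G Ω) (hF0 : F 0 = 0)
    (hne : ¬ (fun w : ℂ => F (0, w)) =ᶠ[𝓝 0] 0) (hfr : ∃ᶠ x in 𝓝[≠] (0 : ℂ × ℂ), F x = 0 ∧ G x = 0) :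
    ∃ γ : ℂ → ℂ × ℂ, AnalyticAt ℂ γ 0 ∧ γ 0 = 0 ∧ (∀ s, s ≠ 0 → γ s ≠ 0) ∧
      ∀ᶠ s in 𝓝 0, F (γ s) = 0 ∧ G (γ s) = 0 := by
  classical
  -- Weierstrass box at the origin
  obtain ⟨ε, r, R, hε, hbox, hW, huniq, -⟩ :=
    exists_weierstrassData hΩ hF.differentiableOn (z₀ := (0 : ℂ)) (c := (0 : ℂ)) h0 hne
  -- root parametrisation of the reduced polynomial after `z = s ^ q`
  obtain ⟨q, k, ε₁, g, hq, hε₁, hε₁ε, hg, hroots⟩ := exists_root_parametrisation hε hW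
  set V : Set ℂ := {s | s ^ q ∈ ball (0 : ℂ) ε₁} with hV_def
  have hVo : IsOpen V := isOpen_ball.preimage (continuous_id.pow q)
  have hV0 : (0 : ℂ) ∈ V := by
    show (0 : ℂ) ^ q ∈ ball (0 : ℂ) ε₁
    rw [zero_pow hq.ne']; exact mem_ball_self hε₁
  have hVn : V ∈ 𝓝 (0 : ℂ) := hVo.mem_nhds hV0
  -- along each sheet: a slice zero of `F` in the fibre disc
  have hgF : ∀ l, ∀ s ∈ V, s ≠ 0 → g l s ∈ ball (0 : ℂ) r ∧ F (s ^ q, g l s) = 0 := by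
    intro l s hs hs0
    have hmem : g l s ∈ (sliceRoots F 0 r (s ^ q)).toFinset := (hroots s hs hs0 _).2 ⟨l, rfl⟩
    exact (mem_toFinset_sliceRoots hW (ball_subset_ball hε₁ε hs) _).1 hmem
  have hgan : ∀ l, ∀ s ∈ V, AnalyticAt ℂ (g l) s := fun l s hs => (hg l).analyticAt (hVo.mem_nhds hs)
  have hpun : ∀ᶠ s in 𝓝[≠] (0 : ℂ), s ∈ V ∧ s ≠ 0 := by
    filter_upwards [mem_nhdsWithin_of_mem_nhds hVn, self_mem_nhdsWithin] with s hs hs0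
    exact ⟨hs, hs0⟩
  -- `g l 0 = 0`: by continuity `F (0, g l 0) = 0` with `‖g l 0‖ ≤ r`, and `0` is the only such slice zero
  have hg0 : ∀ l, g l 0 = 0 := by
    intro l
    have htend : Tendsto (g l) (𝓝[≠] 0) (𝓝 (g l 0)) :=
      ((hgan l 0 hV0).continuousAt.tendsto).mono_left nhdsWithin_le_nhds
    have hcl : g l 0 ∈ closedBall (0 : ℂ) r :=
      isClosed_closedBall.mem_of_tendsto htend
        (hpun.mono fun s hs => ball_subset_closedBall (hgF l s hs.1 hs.2).1)
    have hΩmem : ((0 : ℂ), g l 0) ∈ Ω :=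
      hbox (mk_mem_prod (mem_ball_self hε) (closedBall_subset_ball hW.lt hcl))
    have hcomp : Tendsto (fun s => F (s ^ q, g l s)) (𝓝[≠] 0) (𝓝 (F (0, g l 0))) := by
      have hp : Tendsto (fun s : ℂ => s ^ q) (𝓝[≠] 0) (𝓝 0) :=
        ((continuous_pow q).tendsto' (0 : ℂ) 0 (zero_pow hq.ne')).mono_left nhdsWithin_le_nhds
      exact (hF _ hΩmem).continuousAt.tendsto.comp (hp.prodMk_nhds htend)
    have hzero : Tendsto (fun s => F (s ^ q, g l s)) (𝓝[≠] 0) (𝓝 0) :=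
      tendsto_const_nhds.congr' (hpun.mono fun s hs => ((hgF l s hs.1 hs.2).2).symm)
    have hF00 : F (0, g l 0) = 0 := tendsto_nhds_unique hcomp hzero
    by_contra hne0
    exact huniq _ hcl hne0 hF00
  -- the candidate curves `γₗ s = (s ^ q, gₗ s)`
  set γ : Fin k → ℂ → ℂ × ℂ := fun l s => (s ^ q, g l s) with hγ_def
  have hγan : ∀ l, AnalyticAt ℂ (γ l) 0 := fun l =>
    ((differentiable_pow q).analyticAt 0).prod (hgan l 0 hV0)
  have hγ0 : ∀ l, γ l 0 = 0 := fun l => by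
    show ((0 : ℂ) ^ q, g l 0) = 0
    rw [zero_pow hq.ne', hg0 l]; rfl
  have hγne : ∀ l s, s ≠ 0 → γ l s ≠ 0 := fun l s hs h => by
    have h1 : s ^ q = 0 := (Prod.ext_iff.1 h).1
    exact hs (pow_eq_zero_iff hq.ne' |>.1 h1)
  have hγF : ∀ l, ∀ᶠ s in 𝓝 0, F (γ l s) = 0 := fun l => by
    filter_upwards [hVn] with s hs
    by_cases hs0 : s = 0
    · subst hs0; rw [hγ0]; exact hF0
    · exact (hgF l s hs hs0).2
  -- PIGEONHOLE: some `G ∘ γₗ` vanishes frequently at `0`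
  obtain ⟨l, hl⟩ : ∃ l, ∃ᶠ s in 𝓝[≠] (0 : ℂ), G (γ l s) = 0 := by
    by_contra hnone
    rw [not_exists] at hnone
    simp only [not_frequently] at hnone
    have hall : ∀ᶠ s in 𝓝[≠] (0 : ℂ), ∀ l, ¬ G (γ l s) = 0 := eventually_all.2 hnone
    obtain ⟨δ, hδ, hδsub⟩ := Metric.mem_nhdsWithin_iff.1 hall
    set δ' : ℝ := min δ (min 1 ε₁) with hδ'_def
    have hδ' : 0 < δ' := lt_min hδ (lt_min one_pos hε₁)
    have hδ'δ : δ' ≤ δ := min_le_left _ _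
    have hδ'1 : δ' ≤ 1 := (min_le_right _ _).trans (min_le_left _ _)
    have hδ'ε₁ : δ' ≤ ε₁ := (min_le_right _ _).trans (min_le_right _ _)
    have hδq : δ' ^ q ≤ δ' := pow_le_of_le_one hδ'.le hδ'1 hq.ne'
    -- a punctured neighbourhood of `0 ∈ ℂ²` free of common zeros
    have hN : ∀ᶠ x in 𝓝[≠] (0 : ℂ × ℂ), x ∈ ball (0 : ℂ) (δ' ^ q) ×ˢ ball (0 : ℂ) r ∧ x ≠ 0 := by
      filter_upwards [mem_nhdsWithin_of_mem_nhds
        (prod_mem_nhds (ball_mem_nhds (0 : ℂ) (pow_pos hδ' q)) (ball_mem_nhds (0 : ℂ) hW.pos)),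
        self_mem_nhdsWithin] with x hx hx0
      exact ⟨hx, hx0⟩
    have hno : ∀ᶠ x in 𝓝[≠] (0 : ℂ × ℂ), ¬ (F x = 0 ∧ G x = 0) := by
      refine hN.mono ?_
      rintro ⟨z, w⟩ ⟨⟨hz, hw⟩, hx0⟩ ⟨hFx, hGx⟩
      have hzq : ‖z‖ < δ' ^ q := mem_ball_zero_iff.1 hz
      have hzε₁ : z ∈ ball (0 : ℂ) ε₁ := mem_ball_zero_iff.2 (by linarith)
      have hzε : z ∈ ball (0 : ℂ) ε := ball_subset_ball hε₁ε hzε₁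
      by_cases hz0 : z = 0
      · subst hz0
        have hw0 : w ≠ 0 := fun h => hx0 (by rw [h]; rfl)
        exact huniq w (ball_subset_closedBall hw) hw0 hFx
      · obtain ⟨y, hy⟩ := IsAlgClosed.exists_pow_nat_eq z hq
        have hy_norm : ‖y‖ < δ' := by
          apply lt_of_pow_lt_pow_left₀ q hδ'.le
          rwa [← norm_pow, hy]
        have hy0 : y ≠ 0 := by rintro rfl; exact hz0 (by rw [← hy, zero_pow hq.ne'])
        have hyV : y ∈ V := by show y ^ q ∈ ball (0 : ℂ) ε₁; rwa [hy]
        have hwmem : w ∈ (sliceRoots F 0 r (y ^ q)).toFinset := by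
          rw [hy]; exact (mem_toFinset_sliceRoots hW hzε w).2 ⟨hw, hFx⟩
        obtain ⟨l, hl⟩ := (hroots y hyV hy0 w).1 hwmem
        have hGne : ¬ G (γ l y) = 0 :=
          hδsub ⟨mem_ball_zero_iff.2 (hy_norm.trans_le hδ'δ), hy0⟩ l
        apply hGne
        show G (y ^ q, g l y) = 0
        rw [hy, ← hl]; exact hGx
    obtain ⟨x, hx1, hx2⟩ := (hno.and_frequently hfr).exists
    exact hx1 hx2
  -- identity theorem for `G ∘ γₗ`
  have hGγ : AnalyticAt ℂ (fun s => G (γ l s)) 0 := by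
    have h : AnalyticAt ℂ G (γ l 0) := by rw [hγ0]; exact hG 0 h0
    exact h.comp (hγan l)
  have hGev : ∀ᶠ s in 𝓝 0, G (γ l s) = 0 := by
    rcases hGγ.eventually_eq_zero_or_eventually_ne_zero with h | h
    · exact h
    · exact absurd h (by simpa [not_frequently] using hl)
  exact ⟨γ l, hγan l, hγ0 l, hγne l, (hγF l).and hGev⟩

/-! ### §3  Reductions: a line on which `F ≢ 0`, an affine frame, the general point -/

/-- The complex line `t ↦ p + t • v` is analytic. [folklore] -/
theorem analyticAt_line (p v : ℂ × ℂ) (t : ℂ) : AnalyticAt ℂ (fun t : ℂ => p + t • v) t := by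
  have h : (fun t : ℂ => p + t • v) = fun t => p + ((1 : ℂ →L[ℂ] ℂ).smulRight v) t := by
    ext t <;> simp
  rw [h]
  exact analyticAt_const.add (ContinuousLinearMap.analyticAt _ _)

/-- A holomorphic germ `F ≢ 0` at `p ∈ ℂ²` restricts non-trivially to SOME complex line through `p`
(else, by the one-variable identity theorem on each line, `F ≡ 0` on a ball around `p`). [folklore] -/
theorem exists_line_not_eventually_zero {F : ℂ × ℂ → ℂ} {p : ℂ × ℂ} (hF : AnalyticAt ℂ F p)
    (hne : ¬ F =ᶠ[𝓝 p] 0) : ∃ v : ℂ × ℂ, ¬ (fun t : ℂ => F (p + t • v)) =ᶠ[𝓝 0] 0 := by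
  obtain ⟨ρ, hρ, hFan⟩ := hF.exists_ball_analyticOnNhd
  by_contra h
  push Not at h
  apply hne
  filter_upwards [ball_mem_nhds p hρ] with x hx
  set v : ℂ × ℂ := x - p with hv
  by_cases hv0 : v = 0
  · have hxp : x = p := by rwa [hv, sub_eq_zero] at hv0
    have h0 := (h v).eq_of_nhds
    simp only [zero_smul, add_zero, Pi.zero_apply] at h0
    rw [hxp]; exact h0
  · have hvn : 0 < ‖v‖ := norm_pos_iff.2 hv0
    have hline : AnalyticOnNhd ℂ (fun t : ℂ => F (p + t • v)) (ball (0 : ℂ) (ρ / ‖v‖)) := by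
      intro t ht
      have hmem : p + t • v ∈ ball p ρ := by
        rw [mem_ball, dist_eq_norm, add_sub_cancel_left, norm_smul]
        have ht' := mem_ball_zero_iff.1 ht
        rwa [lt_div_iff₀ hvn] at ht'
      exact AnalyticAt.comp (f := fun t : ℂ => p + t • v) (x := t) (hFan _ hmem) (analyticAt_line p v t)
    have h1 : (1 : ℂ) ∈ ball (0 : ℂ) (ρ / ‖v‖) := by
      rw [mem_ball_zero_iff, norm_one, one_lt_div hvn]
      have hx' := mem_ball.1 hx
      rwa [dist_eq_norm] at hx'
    have hzero := hline.eqOn_zero_of_preconnected_of_eventuallyEq_zero (convex_ball _ _).isPreconnected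
      (mem_ball_self (div_pos hρ hvn)) (h v) h1
    simp only [one_smul, hv, add_sub_cancel, Pi.zero_apply] at hzero
    exact hzero

/-- A linear automorphism of `ℂ²` mapping the second coordinate axis onto the line `ℂ • v`, `v ≠ 0`. [folklore] -/
theorem exists_frame {v : ℂ × ℂ} (hv : v ≠ 0) :
    ∃ e : (ℂ × ℂ) ≃L[ℂ] (ℂ × ℂ), ∀ w : ℂ, e (0, w) = w • v := by
  obtain ⟨a, b⟩ := v
  set u : ℂ × ℂ := if b = 0 then (0, 1) else (1, 0) with hu_def
  set f : (ℂ × ℂ) →ₗ[ℂ] (ℂ × ℂ) :=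
    (LinearMap.fst ℂ ℂ ℂ).smulRight u + (LinearMap.snd ℂ ℂ ℂ).smulRight (a, b) with hf_def
  have hf : ∀ x : ℂ × ℂ, f x = x.1 • u + x.2 • (a, b) := fun x => rfl
  have hinj : Function.Injective f := by
    refine (injective_iff_map_eq_zero f).2 fun x hx => ?_
    rw [hf] at hx
    obtain ⟨z, w⟩ := x
    have hx' := Prod.ext_iff.1 hx
    by_cases hb : b = 0
    · subst hb
      have ha : a ≠ 0 := by rintro rfl; exact hv rfl
      simp only [hu_def, if_true, Prod.smul_mk, smul_eq_mul, mul_zero, mul_one, Prod.mk_add_mk, zero_add,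
        add_zero, Prod.fst_zero, Prod.snd_zero] at hx'
      obtain ⟨h1, h2⟩ := hx'
      have hw : w = 0 := by simpa [ha] using h1
      rw [hw, h2]; rfl
    · simp only [hu_def, hb, if_false, Prod.smul_mk, smul_eq_mul, mul_zero, mul_one, Prod.mk_add_mk,
        Prod.fst_zero, Prod.snd_zero] at hx'
      obtain ⟨h1, h2⟩ := hx'
      have hw : w = 0 := by simpa [hb] using h2
      rw [hw, zero_mul, add_zero] at h1
      rw [hw, h1]; rfl
  refine ⟨(LinearMap.linearEquivOfInjective f hinj rfl).toContinuousLinearEquiv, fun w => ?_⟩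
  rw [LinearEquiv.coe_toContinuousLinearEquiv', LinearMap.linearEquivOfInjective_apply, hf]
  simp

/-- **Curve selection for a pair `(F, G)` at a general point `p`**, `F ≢ 0` near `p`: transport of
`exists_curve_at_zero` along the affine chart `x ↦ p + e x`. [folklore] -/
theorem exists_curve_of_pair {F G : ℂ × ℂ → ℂ} {p : ℂ × ℂ} (hF : AnalyticAt ℂ F p) (hG : AnalyticAt ℂ G p)
    (hF0 : F p = 0) (hne : ¬ F =ᶠ[𝓝 p] 0) (hfr : ∃ᶠ x in 𝓝[≠] p, F x = 0 ∧ G x = 0) :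
    ∃ γ : ℂ → ℂ × ℂ, AnalyticAt ℂ γ 0 ∧ γ 0 = p ∧ (∀ s, s ≠ 0 → γ s ≠ p) ∧
      ∀ᶠ s in 𝓝 0, F (γ s) = 0 ∧ G (γ s) = 0 := by
  -- a line through `p` on which `F ≢ 0`, and a frame putting it on the second axis
  obtain ⟨v, hv⟩ := exists_line_not_eventually_zero hF hne
  have hv0 : v ≠ 0 := by
    rintro rfl
    apply hv
    simp only [smul_zero, add_zero, hF0]
    exact EventuallyEq.rfl
  obtain ⟨e, he⟩ := exists_frame hv0
  set L : ℂ × ℂ → ℂ × ℂ := fun x => p + e x with hL_def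
  have hLan : ∀ x, AnalyticAt ℂ L x := fun x => analyticAt_const.add (e.analyticAt x)
  have hL0 : L 0 = p := by simp [hL_def]
  have hLc : Continuous L := continuous_const.add e.continuous
  -- a common domain of analyticity, pulled back by `L`
  obtain ⟨ρF, hρF, hFan⟩ := hF.exists_ball_analyticOnNhd
  obtain ⟨ρG, hρG, hGan⟩ := hG.exists_ball_analyticOnNhd
  set Ω : Set (ℂ × ℂ) := L ⁻¹' ball p (min ρF ρG) with hΩ_def
  have hΩo : IsOpen Ω := isOpen_ball.preimage hLc
  have hΩ0 : (0 : ℂ × ℂ) ∈ Ω := by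
    show L 0 ∈ ball p (min ρF ρG)
    rw [hL0]; exact mem_ball_self (lt_min hρF hρG)
  have hFL : AnalyticOnNhd ℂ (F ∘ L) Ω := fun x hx =>
    (hFan _ (ball_subset_ball (min_le_left _ _) hx)).comp (hLan x)
  have hGL : AnalyticOnNhd ℂ (G ∘ L) Ω := fun x hx =>
    (hGan _ (ball_subset_ball (min_le_right _ _) hx)).comp (hLan x)
  -- transport of the hypotheses
  have hneL : ¬ (fun w : ℂ => (F ∘ L) (0, w)) =ᶠ[𝓝 0] 0 := by
    have h : (fun w : ℂ => (F ∘ L) (0, w)) = fun t => F (p + t • v) := by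
      ext w; simp only [Function.comp, hL_def, he]
    rwa [h]
  set Lh : ℂ × ℂ ≃ₜ ℂ × ℂ := e.toHomeomorph.trans (Homeomorph.addLeft p) with hLh_def
  have hLh : (Lh : ℂ × ℂ → ℂ × ℂ) = L := rfl
  have hfrL : ∃ᶠ x in 𝓝[≠] (0 : ℂ × ℂ), (F ∘ L) x = 0 ∧ (G ∘ L) x = 0 := by
    have hmap : map L (𝓝[≠] (0 : ℂ × ℂ)) = 𝓝[≠] p := by rw [← hLh, Lh.map_punctured_nhds_eq, hLh, hL0]
    rw [← hmap, frequently_map] at hfr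
    exact hfr
  obtain ⟨γ, hγan, hγ0, hγne, hγev⟩ :=
    exists_curve_at_zero hΩo hΩ0 hFL hGL (by simp only [Function.comp, hL0, hF0]) hneL hfrL
  refine ⟨L ∘ γ, (hLan _).comp hγan, by simp only [Function.comp, hγ0, hL0], fun s hs h => hγne s hs ?_, hγev⟩
  have h' : p + e (γ s) = p := h
  rw [add_eq_left] at h'
  exact (e.map_eq_zero_iff).1 h'

end CurveSel

/-! ### §4  The discharge -/

open CurveSel in
/-- **THEOREM (lens 4, g38).**  The fact `CurveSelection` of part 09 HOLDS: at a non-isolated zero `p` of an analytic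
map germ `Φ : ℂ² → ℂ²` there is a non-constant analytic curve germ `γ : (ℂ, 0) → (ℂ², p)` inside `{Φ = 0}`.
[cite: Chirka1989, §3.5 Prop. 1, §6.1] [cite: ParusinskiRond2012, Prop. 2.1] -/
theorem curveSelection_holds : CurveSelection := by
  intro Φ p hΦ hp hfr
  have h1 : AnalyticAt ℂ (fun x => (Φ x).1) p := analyticAt_fst.comp hΦ
  have h2 : AnalyticAt ℂ (fun x => (Φ x).2) p := analyticAt_snd.comp hΦ
  have hzero : ∀ x, Φ x = 0 ↔ (Φ x).1 = 0 ∧ (Φ x).2 = 0 := fun x => Prod.ext_iff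
  by_cases hA : (fun x => (Φ x).1) =ᶠ[𝓝 p] 0 ∧ (fun x => (Φ x).2) =ᶠ[𝓝 p] 0
  · -- both components vanish identically near `p`: a coordinate line does it
    refine ⟨fun s => p + (s, 0), analyticAt_const.add ((analyticAt_id).prod analyticAt_const), by simp, ?_, ?_⟩
    · intro h
      exact not_eventually_eq_nhds 0 0 (h.mono fun s hs => by simpa [Prod.ext_iff] using hs)
    · have hc : Tendsto (fun s : ℂ => p + (s, 0)) (𝓝 0) (𝓝 p) :=
        (by fun_prop : Continuous fun s : ℂ => p + (s, 0)).tendsto' 0 p (by simp)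
      filter_upwards [hc.eventually (hA.1.and hA.2)] with s hs
      exact (hzero _).2 hs
  · have hp1 : (Φ p).1 = 0 := by rw [hp]; rfl
    have hp2 : (Φ p).2 = 0 := by rw [hp]; rfl
    have hfr' : ∃ᶠ x in 𝓝[≠] p, (Φ x).1 = 0 ∧ (Φ x).2 = 0 := hfr.mono fun x hx => (hzero x).1 hx
    rw [not_and_or] at hA
    rcases hA with hA | hA
    · obtain ⟨γ, hγ, hγ0, hγne, hγev⟩ := exists_curve_of_pair h1 h2 hp1 hA hfr'
      exact ⟨γ, hγ, hγ0, fun h => not_eventually_eq_nhds 0 0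
        (h.mono fun s hs => by_contra fun hs0 => hγne s hs0 hs), hγev.mono fun s hs => (hzero _).2 hs⟩
    · obtain ⟨γ, hγ, hγ0, hγne, hγev⟩ :=
        exists_curve_of_pair h2 h1 hp2 hA (hfr'.mono fun x hx => hx.symm)
      exact ⟨γ, hγ, hγ0, fun h => not_eventually_eq_nhds 0 0
        (h.mono fun s hs => by_contra fun hs0 => hγne s hs0 hs), hγev.mono fun s hs => (hzero _).2 hs.symm⟩

/-! ### §5  READ-OUTS: T″ modulo Ax only; the cell modulo {Ax (tree-proved, by name), IsolatedPointBound} and the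
two E-side facts — INSTANTIATIONS of the tree consumers of parts 10 and 15 at `curveSelection_holds` -/

section CellClosure

open Summit.Schanuel.Schanuel.Theorems.RootDecomp1KHyper (LWMeasure)
open Summit.Schanuel.Schanuel.Theorems.RootDecomp1KHyper.HyperCell (HyperLiouville ExplicitRatExpApprox)
open Summit.Schanuel.Schanuel.Theorems.RootDecomp1KGeneric (LiouvilleOrder)
open Summit.Schanuel.Schanuel.Theorems.RootDecomp1KFiniteOrderCell (towerNumber)
open Summit.Schanuel.Schanuel.Theorems.RootDecomp1BFedFlagCore (polarDeg)

/-- **T″ = `IsolatedIntersectionGeneral` MODULO THE TREE Ax STATEMENT ONLY** (part 10's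
`isolatedIntersectionGeneral_of_curveSelection` with `CurveSelection` discharged). -/
theorem isolatedIntersectionGeneral_of_ax (hAx : AxRankBoundLaurent) : IsolatedIntersectionGeneral :=
  isolatedIntersectionGeneral_of_curveSelection curveSelection_holds hAx

/-- … hence the kernel's `IsolatedIntersection ρ` for every real `ρ`, modulo Ax only. -/
theorem isolatedIntersection_of_ax (hAx : AxRankBoundLaurent) (ρ : ℝ) : IsolatedIntersection ρ :=
  isolatedIntersection_of_curveSelection curveSelection_holds hAx ρ

/-- **THE CELL's MZ INPUT `MovingZeroApprox ρ` FOR EVERY REAL `ρ`** modulo TWO named inputs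
{`AxRankBoundLaurent` (Ax 1971, tree-PROVED in `Literature/…/AxSchanuelUniv`, carried by name), `IsolatedPointBound`
(B, print)} — part 15's `movingZeroApprox_of_three_facts` with `CurveSelection` discharged. -/
theorem movingZeroApprox_of_two_facts (hAx : AxRankBoundLaurent) (hB : IsolatedPointBound) (ρ : ℝ) :
    MovingZeroApprox ρ :=
  movingZeroApprox_of_three_facts curveSelection_holds hAx hB ρ

/-- **THE CELL X(2) AT `(1, ρ)` for every real `ρ` of exponential Liouville order `8`**, modulo the two registered
E-side facts (`LWMeasure`, `ExplicitRatExpApprox`) and the TWO remaining moving-zero inputs. -/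
theorem four_le_polarDeg_one_of_two_facts (hLW : LWMeasure) (hX : ExplicitRatExpApprox)
    (hAx : AxRankBoundLaurent) (hB : IsolatedPointBound) {ρ : ℝ} (hρ : LiouvilleOrder 8 ρ) :
    ((2 + 2 : ℕ) : Cardinal) ≤ polarDeg ![(1 : ℝ), ρ] :=
  four_le_polarDeg_one_of_three_facts hLW hX curveSelection_holds hAx hB hρ

/-- … the swapped cell `(ρ, 1)`. -/
theorem four_le_polarDeg_swap_of_two_facts (hLW : LWMeasure) (hX : ExplicitRatExpApprox)
    (hAx : AxRankBoundLaurent) (hB : IsolatedPointBound) {ρ : ℝ} (hρ : LiouvilleOrder 8 ρ) :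
    ((2 + 2 : ℕ) : Cardinal) ≤ polarDeg ![ρ, (1 : ℝ)] :=
  four_le_polarDeg_swap_of_three_facts hLW hX curveSelection_holds hAx hB hρ

/-- … the hyper-Liouville class (1K item 33363's class). -/
theorem four_le_polarDeg_one_hyper_of_two_facts (hLW : LWMeasure) (hX : ExplicitRatExpApprox)
    (hAx : AxRankBoundLaurent) (hB : IsolatedPointBound) {ρ : ℝ} (hρ : HyperLiouville ρ) :
    ((2 + 2 : ℕ) : Cardinal) ≤ polarDeg ![(1 : ℝ), ρ] :=
  four_le_polarDeg_one_hyper_of_three_facts hLW hX curveSelection_holds hAx hB hρ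

/-- **X(2) AT `(1, ρ_T)`, `ρ_T = towerNumber 9` NOT hyper-Liouville**, modulo the same named inputs. -/
theorem four_le_polarDeg_one_rhoT_of_two_facts (hLW : LWMeasure) (hX : ExplicitRatExpApprox)
    (hAx : AxRankBoundLaurent) (hB : IsolatedPointBound) :
    ((2 + 2 : ℕ) : Cardinal) ≤ polarDeg ![(1 : ℝ), towerNumber 9] :=
  four_le_polarDeg_one_rhoT_of_three_facts hLW hX curveSelection_holds hAx hB

end CellClosure

end Summit.Schanuel.Schanuel.Theorems.RootDecomp1BMovingZero
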